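import Mathlib
import Summits.RiemannHypothesis.RiemannHypothesis.Theorems.WeilFormatCCellShiftCertA09729p4
import Summits.RiemannHypothesis.RiemannHypothesis.Theorems.WeilFormatCCellShiftCertA09729p4T
import Summits.RiemannHypothesis.RiemannHypothesis.Theorems.WeilFormatCCellShiftCertRange
import HarnessLib

/-!
# Kernel class parts of the cell-refined shift certificate `cellA09729p4`: the structural check; the merged-table check; row-range parts 0, 1

Helper file (`--supports stmt-RiemannHypothesis-0098`), RH-free; seat rh-explicit-weil-1 gen4; re-split into ≤ 35-s files by gen5 (lead R9-34 (C)).  One `decide +kernel` pair pass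
per class part of `CellSOS.cellA09729p4` (`WeilFormatCCellShiftCertA09729p4.lean`); consumed by the bound file together with `cellA09729p4_check`.
-/

set_option linter.dupNamespace false

namespace Summit.RiemannHypothesis.RiemannHypothesis.Theorems.WeilFormatC.CellSOS

set_option maxHeartbeats 0 in
/-- The cheap structural check of `cellA09729p4` (kernel). [folklore] -/
theorem cellA09729p4_check : cellA09729p4.check = true := by
  decide +kernel

set_option maxHeartbeats 0 in
set_option maxRecDepth 100000 in
/-- The merged claimed tables of `cellA09729p4` pass the final class-bound check (kernel). [folklore] -/
theorem cellA09729p4_merge : cellA09729p4.checkMerge cellA09729p4T = true := by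
  decide +kernel

set_option maxHeartbeats 0 in
set_option maxRecDepth 100000 in
/-- Row-range part 0 of `cellA09729p4`: the kernel's partial class table IS the claimed one. [folklore] -/
theorem cellA09729p4_tabR0 : cellA09729p4.checkTab cellA09729p4T 0 = true := by
  decide +kernel

set_option maxHeartbeats 0 in
set_option maxRecDepth 100000 in
/-- Row-range part 1 of `cellA09729p4`: the kernel's partial class table IS the claimed one. [folklore] -/
theorem cellA09729p4_tabR1 : cellA09729p4.checkTab cellA09729p4T 1 = true := by
  decide +kernel

end Summit.RiemannHypothesis.RiemannHypothesis.Theorems.WeilFormatC.CellSOS
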